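import Literature.MathematicalPhysics.QuantumLattice.HubbardGridFlowValid
import Literature.MathematicalPhysics.QuantumLattice.HubbardGridTwoPointBound
import Literature.MathematicalPhysics.QuantumLattice.HubbardComplexCouplingRatio
import Literature.MathematicalPhysics.QuantumLattice.HubbardHartreePicard
import HarnessLib

/-!
# The two-point ratio of the Hubbard torus is bounded on the complex disc `|u| ≤ κ_U/β`, uniformly in `β ≥ β₀`, `L`, `M`

Topic `MathematicalPhysics/QuantumLattice`; cell gate-hubbard-kl, R0-SCOPE-4 P7 (assembly of the finite-`M` bound).  For `μ` in a
compact box away from half filling and from the band bottom (`d₀ + δ ≤ μ + 4`, `d₀ + δ ≤ -μ`), the infrared scale `Λ₀` of the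
ultraviolet block with `4π/β ≤ Λ₀ ≤ min(1, d₀/2)`, a complex coupling `|u| ≤ κ_U/β` with the smallness conditions of the flow
(`HubbardGridFlowBudget`), Matsubara cutoff `M ≥ M₀(β)` with `N = 4M` time-grid points and `L ≥ 2β√(d₀/8)`, the ratio
`R_{L,M}(u)` of `HubbardComplexCouplingRatio` is represented on the grid (`hubbardRatio_eq_grid`) with the Hartree counterterm of
`HubbardHartreePicard`, the data assemble into a `FlowSetup` (`betaUSetup`) satisfying `FlowSetup.Concrete` (`betaUSetup_concrete`),
and `FlowSetup.Valid.norm_twoPoint_div_le` gives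

**`norm_hubbardRatio_le_betaUMb`**: `hubbardRatioDen ≠ 0` and `‖R_{L,M}(u)‖ ≤ Mb(d₀, Λ₀, C_uv, C_sl, κ_U)` — a constant independent of
`β`, `L`, `M` and `u` (Benfatto–Giuliani–Mastropietro 2006, Thm 2.1 in the corner `βU ≤ κ`: the Schwinger functions are analytic and
bounded in `|U| ≤ κ/β` uniformly in the volume and in the Matsubara cutoff).

Everything is proved; the definitions are the explicit constants and the setup; no named facts.

## Sources

G. Benfatto, A. Giuliani, V. Mastropietro, Ann. Henri Poincaré 7 (2006) 809–898, Thm 2.1, §2.2–§2.9 (`BenfattoGiulianiMastropietro2006`);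
W. Pedra, M. Salmhofer, Comm. Math. Phys. 279 (2008) 1–30, Thm 2.4 (`PedraSalmhofer2008`).
-/

noncomputable section

namespace Literature.MathematicalPhysics.QuantumLattice

open GrassmannAlgebra Finset Literature.Probability.LatticeModels Complex

/-! ### The constants -/

/-- `W̄₀ = e²(κ₀ + √r √(AΛ₀))`. [cite: BenfattoGiulianiMastropietro2006, §2.8 (2.88)] -/
def betaW0 (d₀ Λ₀ : ℝ) : ℝ := Real.exp 2 * (kappaUV d₀ Λ₀ + flowSqr * Real.sqrt (sliceGramA d₀ * Λ₀))

/-- `E₁`. [cite: BenfattoGiulianiMastropietro2006, §2.8 (2.88)] -/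
def betaE1 (d₀ : ℝ) : ℝ := 4 * Real.exp 4 * sliceGramA d₀ * (1 + 2 * sliceGramA d₀) + 16 * Real.exp 8 * sliceGramA d₀ ^ 2

/-- `E₂`. [cite: BenfattoGiulianiMastropietro2006, §2.8 (2.88)] -/
def betaE2 (Csl d₀ : ℝ) : ℝ := Real.exp 1 * Csl * betaE1 d₀ / sliceGramA d₀

/-- `E₄` (with `τ₀ = 1`). [cite: BenfattoGiulianiMastropietro2006, §2.8 (2.88)] -/
def betaE4 (Cuv d₀ Λ₀ : ℝ) : ℝ := Real.exp 1 * Cuv / kappaUV d₀ Λ₀ ^ 2 * (betaW0 d₀ Λ₀ ^ 2 * 1 + betaW0 d₀ Λ₀ ^ 4)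

/-- `Γ̄₀`. [cite: BenfattoGiulianiMastropietro2006, §2.8 (2.88)] -/
def betaGam0 (Cuv Csl d₀ Λ₀ : ℝ) : ℝ :=
  Real.exp 1 * flowG * Csl * kappaUV d₀ Λ₀ ^ 2 * (flowR ^ 2 * flowSqr) / (Cuv * sliceGramA d₀ * (Λ₀ ^ 2 * Real.sqrt Λ₀))

/-- `E₆`. [cite: BenfattoGiulianiMastropietro2006, §2.8 (2.88)] -/
def betaE6 (Cuv Csl d₀ Λ₀ : ℝ) : ℝ :=
  (Λ₀ / Real.pi) ^ 2 * (30 / 29 * betaGam0 Cuv Csl d₀ Λ₀ * betaE4 Cuv d₀ Λ₀ ^ 2) + 60 / 11 * betaE2 Csl d₀ ^ 2 * Λ₀ * flowR / Real.pi ^ 2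

/-- **The uniform bound** `Mb = (κ₀² + 2AΛ₀)(1 + 2(2π^{3/2}C_uv/(29C_sl) + 4/29 + πκ_UC_uv + 2κ_UC_sl/√π))`.
[cite: BenfattoGiulianiMastropietro2006, Thm 2.1] -/
def betaUMb (Cuv Csl d₀ Λ₀ κU : ℝ) : ℝ :=
  (kappaUV d₀ Λ₀ ^ 2 + 2 * sliceGramA d₀ * Λ₀) *
    (1 + 2 * (2 * Real.pi * Real.sqrt Real.pi * Cuv / (29 * Csl) + 4 / 29 + Real.pi * κU * Cuv + 2 * κU * Csl / Real.sqrt Real.pi))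

/-! ### The setup -/

/-- **The flow setup of the corner `βU ≤ κ`** at complex coupling `u`: Hartree shift `w = hartreeShift`, `μ_R = μ + Re w`,
`θ = Im w`, `ν₀ = -uT₁`, `τ₀ = 1`. [cite: BenfattoGiulianiMastropietro2006, §2.8 (2.85)-(2.88)] -/
def betaUSetup (L M N : ℕ) [NeZero L] (Cuv Csl d₀ Λ₀ κU β μ : ℝ) (K : ℕ) (u : ℂ) : FlowSetup L M N where
  Cuv := Cuv
  Csl := Csl
  A := sliceGramA d₀
  κ₀ := kappaUV d₀ Λ₀
  τ₀ := 1
  κU := κU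
  β := β
  μR := μ + (hartreeShift L M β μ u).re
  θ := (hartreeShift L M β μ u).im
  Λ₀ := Λ₀
  K := K
  u := u
  ν₀ := -(u * hartreeT1 L M β μ u)

variable {L M N : ℕ} [NeZero L]

/-- The constants of the setup are the standalone ones. [cite: BenfattoGiulianiMastropietro2006, §2.8 (2.88)] -/
theorem betaUSetup_E (Cuv Csl d₀ Λ₀ κU β μ : ℝ) (K : ℕ) (u : ℂ) :
    (betaUSetup L M N Cuv Csl d₀ Λ₀ κU β μ K u).E₂ = betaE2 Csl d₀ ∧ (betaUSetup L M N Cuv Csl d₀ Λ₀ κU β μ K u).E₄ = betaE4 Cuv d₀ Λ₀ ∧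
      (betaUSetup L M N Cuv Csl d₀ Λ₀ κU β μ K u).E₆ = betaE6 Cuv Csl d₀ Λ₀ ∧
      (betaUSetup L M N Cuv Csl d₀ Λ₀ κU β μ K u).Mb = betaUMb Cuv Csl d₀ Λ₀ κU :=
  ⟨rfl, rfl, rfl, rfl⟩

/-! ### The number of scales -/

/-- **The number of infrared scales**: for `Λ₀β ≥ π` there is `K ≥ 1` with `(π/β) r^{K-1} ≤ Λ₀ ≤ (π/β) r^K`.
[cite: BenfattoGiulianiMastropietro2006, §2.2 (2.9)] -/
theorem exists_flowK {β Λ₀ : ℝ} (hβ : 0 < β) (h : Real.pi / β ≤ Λ₀) :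
    ∃ K : ℕ, K ≠ 0 ∧ gridScale β Λ₀ flowR K 1 ≤ Λ₀ ∧ Λ₀ ≤ flowR * gridScale β Λ₀ flowR K 1 := by
  have hx : 1 ≤ Λ₀ * β / Real.pi := by rw [le_div_iff₀ Real.pi_pos, one_mul]; rwa [div_le_iff₀ hβ] at h
  obtain ⟨n, hn1, hn2⟩ := exists_nat_pow_near hx (lt_of_lt_of_le one_lt_two two_le_flowR)
  refine ⟨n + 1, Nat.succ_ne_zero n, ?_, ?_⟩
  · rw [gridScale_of_ne_zero β Λ₀ flowR (n + 1) one_ne_zero, show n + 1 - 1 = n from rfl]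
    rw [le_div_iff₀ Real.pi_pos] at hn1
    rw [div_mul_eq_mul_div, div_le_iff₀ hβ]; linarith
  · rw [gridScale_of_ne_zero β Λ₀ flowR (n + 1) one_ne_zero, show n + 1 - 1 = n from rfl]
    rw [div_lt_iff₀ Real.pi_pos] at hn2
    rw [show flowR * (Real.pi / β * flowR ^ n) = Real.pi / β * flowR ^ (n + 1) by ring, div_mul_eq_mul_div, le_div_iff₀ hβ]
    linarith

/-! ### The concrete conditions -/

section Main

variable [NeZero N] {Cuv Csl d₀ δ Λ₀ κU β μ : ℝ} {K : ℕ} {u : ℂ}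
  (hd₀ : 0 < d₀) (hμ4 : d₀ + δ ≤ μ + 4) (hμ0 : d₀ + δ ≤ -μ) (hβ1 : 1 ≤ β) (hβ3 : 3 / d₀ ≤ β)
  (hΛ₀β : 2 * (2 * Real.pi / β) ≤ Λ₀) (hΛ₀1 : Λ₀ ≤ 1) (hΛ₀d : Λ₀ ≤ d₀ / 2)
  (hK : K ≠ 0) (htop : gridScale β Λ₀ flowR K 1 ≤ Λ₀) (hletop : Λ₀ ≤ flowR * gridScale β Λ₀ flowR K 1)
  (hbox1 : 3 / 2 * κU ≤ Real.pi / 4) (hbox2 : 3 / 2 * κU / β ≤ δ) (hLip : 3 * tadpoleLip L d₀ β * κU ≤ β)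
  (hLip2 : κU ^ 2 * tadpoleLip L d₀ β ^ 2 ≤ Real.pi * β) (hκU : 0 ≤ κU) (hu : ‖u‖ ≤ κU / β)
  (hM : 2 ≤ M) (hMN : 2 * M ≤ N) (hMN' : 4 * M ≤ N + 1) (hNβ : Λ₀ * β ≤ N) (hMβ : (Λ₀ * β) ^ 5 ≤ (2 * (M : ℝ) - 3) ^ 2)
  (hMπ : Λ₀ < Real.pi * (2 * M - 3) / β) (hL : 2 * β * Real.sqrt (d₀ / 8) ≤ L)
  (hCuv : 0 < Cuv) (hCsl : 0 < Csl)
  (Cuv_rows : ∀ (L' M' N' : ℕ) [NeZero L'] [NeZero N'] (β μ θ r : ℝ) (K : ℕ),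
      0 < β → |β * θ| ≤ Real.pi / 4 → Real.pi / β ≤ Λ₀ → 2 * (2 * Real.pi / β) ≤ Λ₀ → 2 ≤ M' → 2 * M' ≤ N' → Λ₀ * β ≤ N' →
      (Λ₀ * β) ^ 5 ≤ (2 * (M' : ℝ) - 3) ^ 2 →
      (∀ X : GridLeg (GridPoint L' N'), ∑ Y, ‖gridScaleCov L' M' N' β μ θ Λ₀ r K 0 X Y‖ ≤ Cuv * (N' / β)) ∧
      (∀ Y : GridLeg (GridPoint L' N'), ∑ X, ‖gridScaleCov L' M' N' β μ θ Λ₀ r K 0 X Y‖ ≤ Cuv * (N' / β)))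
  (Csl_rows : ∀ (L' M' N' : ℕ) [NeZero L'] [NeZero N'] (β μ θ Λ₀ : ℝ) (K j : ℕ), j ≠ 0 → j ≤ K →
      0 < β → d₀ ≤ μ + 4 → d₀ ≤ -μ → |β * θ| ≤ Real.pi / 4 → Real.pi / β ≤ gridScale β Λ₀ flowR K j → gridScale β Λ₀ flowR K j ≤ 1 →
      gridScale β Λ₀ flowR K j ≤ gridScale β Λ₀ flowR K (j - 1) → gridScale β Λ₀ flowR K (j - 1) ≤ flowR * gridScale β Λ₀ flowR K j →
      gridScale β Λ₀ flowR K (j - 1) ≤ d₀ / 2 → gridScale β Λ₀ flowR K (j - 1) < Real.pi * (2 * M' - 3) / β → 2 * M' ≤ N' → 2 ≤ M' →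
      gridScale β Λ₀ flowR K j * β ≤ N' → 2 * Real.pi * Real.sqrt (d₀ / 8) ≤ gridScale β Λ₀ flowR K (j - 1) * L' →
      (∀ X : GridLeg (GridPoint L' N'), ∑ Y, ‖gridScaleCov L' M' N' β μ θ Λ₀ flowR K j X Y‖ ≤
          Csl * (N' / β) / (gridScale β Λ₀ flowR K j * Real.sqrt (gridScale β Λ₀ flowR K j))) ∧
      (∀ Y : GridLeg (GridPoint L' N'), ∑ X, ‖gridScaleCov L' M' N' β μ θ Λ₀ flowR K j X Y‖ ≤
          Csl * (N' / β) / (gridScale β Λ₀ flowR K j * Real.sqrt (gridScale β Λ₀ flowR K j))))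
  (small₁ : κU * (betaE4 Cuv d₀ Λ₀ + betaE2 Csl d₀ / Real.sqrt Real.pi) ≤ 1 / 60) (small₂ : κU ^ 2 * betaE6 Cuv Csl d₀ Λ₀ ≤ 1 / 60)
include hd₀ hμ4 hμ0 hβ1 hβ3 hΛ₀β hΛ₀1 hΛ₀d hK htop hletop hbox1 hbox2 hLip hLip2 hκU hu hM hMN hMN' hNβ hMβ hMπ hL hCuv hCsl Cuv_rows
  Csl_rows small₁ small₂

omit [NeZero N] hMN' in
/-- **The setup satisfies the concrete conditions.** [cite: BenfattoGiulianiMastropietro2006, §2.8 (2.80)-(2.88)] -/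
theorem betaUSetup_concrete : (betaUSetup L M N Cuv Csl d₀ Λ₀ κU β μ K u).Concrete d₀ := by
  have hβ0 : 0 < β := lt_of_lt_of_le one_pos hβ1
  obtain ⟨hre, -, hθ⟩ := hartreeShift_mem_box (M := M) hd₀ hμ4 hμ0 hβ3 hbox1 hbox2 hLip hu
  have hT1 := norm_hartreeT1_le_one (M := M) hd₀ hμ4 hμ0 hβ3 hbox1 hbox2 hLip hu
  have hres := norm_hartree_residual_le (M := M) hd₀ hμ4 hμ0 hβ3 hbox1 hbox2 hLip hu hLip2
  have hre' := abs_le.1 hre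
  refine
    { d₀_pos := hd₀, A_eq := rfl, κ₀_eq := rfl, one_le_β := hβ1, Cuv_pos := hCuv, Csl_pos := hCsl, τ₀_nonneg := zero_le_one
      κU_nonneg := hκU
      μ4 := by show d₀ ≤ μ + (hartreeShift L M β μ u).re + 4; linarith
      μ0 := by show d₀ ≤ -(μ + (hartreeShift L M β μ u).re); linarith
      θ_le := hθ, Λ₀β := hΛ₀β, Λ₀_le_one := hΛ₀1, Λ₀d := hΛ₀d, K_ne_zero := hK, top_le := htop, le_top := hletop
      two_le_M := hM, MN := hMN, Nβ := hNβ, Mβ := hMβ, Mπ := hMπ, L_ge := hL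
      Cuv_rows := Cuv_rows, Csl_rows := Csl_rows
      res := ?_, nu0 := ?_, u_le := hu
      small₁ := by rw [(betaUSetup_E Cuv Csl d₀ Λ₀ κU β μ K u).1, (betaUSetup_E Cuv Csl d₀ Λ₀ κU β μ K u).2.1]; exact small₁
      small₂ := by rw [(betaUSetup_E Cuv Csl d₀ Λ₀ κU β μ K u).2.2.1]; exact small₂ }
  · -- the Hartree residual: `Σ_j t_j = T(w)`
    show ‖-(u * hartreeT1 L M β μ u) + u * ∑ i ∈ range (K + 1),
        gridScaleTadpole L M β (μ + (hartreeShift L M β μ u).re) (hartreeShift L M β μ u).im Λ₀ flowR K i‖ ≤ ‖u‖ * (Real.pi / β)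
    rw [sum_gridScaleTadpole_eq_totalTadpole hβ0 μ _ hθ Λ₀ flowR hK]
    have hw : (((μ + (hartreeShift L M β μ u).re - μ : ℝ) : ℂ) + ((hartreeShift L M β μ u).im : ℂ) * I) = hartreeShift L M β μ u := by
      rw [show μ + (hartreeShift L M β μ u).re - μ = (hartreeShift L M β μ u).re by ring]
      exact Complex.re_add_im _
    rw [hw]
    exact hres
  · show ‖-(u * hartreeT1 L M β μ u)‖ ≤ 1 * ‖u‖
    rw [norm_neg, norm_mul, one_mul]
    exact (mul_le_mul_of_nonneg_left hT1 (norm_nonneg u)).trans (by rw [mul_one])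

/-- **The two-point ratio is bounded on the complex disc**, and its denominator does not vanish.
[cite: BenfattoGiulianiMastropietro2006, Thm 2.1] -/
theorem norm_hubbardRatio_le_betaUMb (x y : TorusSite 2 L) (σ σ' : Fin 2) :
    hubbardRatioDen L M β μ u ≠ 0 ∧ ‖hubbardRatio L M β μ x y σ σ' u‖ ≤ betaUMb Cuv Csl d₀ Λ₀ κU := by
  have hβ0 : 0 < β := lt_of_lt_of_le one_pos hβ1
  set S := betaUSetup L M N Cuv Csl d₀ Λ₀ κU β μ K u with hS
  have hC : S.Concrete d₀ := betaUSetup_concrete hd₀ hμ4 hμ0 hβ1 hβ3 hΛ₀β hΛ₀1 hΛ₀d hK htop hletop hbox1 hbox2 hLip hLip2 hκU hu hM hMN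
    hNβ hMβ hMπ hL hCuv hCsl Cuv_rows Csl_rows small₁ small₂
  have hV : S.Valid := hC.valid
  -- the grid representation with `v = u T₁`
  set v : ℂ := u * hartreeT1 L M β μ u with hv
  have hw' : -(u / 2) - v = hartreeShift L M β μ u := rfl
  obtain ⟨-, -, hθ⟩ := hartreeShift_mem_box (M := M) hd₀ hμ4 hμ0 hβ3 hbox1 hbox2 hLip hu
  have hw : |β * (-(u / 2) - v).im| ≤ Real.pi / 4 := by rw [hw']; exact hθ
  have hgrid := hubbardRatio_eq_grid (N := N) hβ0 μ x y σ σ' u v hw hMN hMN'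
  -- identify with the setup's covariance and interaction
  have hcov : (hubbardGridSub L M β N).transpose * hubbardCovFullShifted L M β (μ + (-(u / 2) - v).re) (-(u / 2) - v).im *
      hubbardGridSub L M β N = S.covFull := by rw [hw']; rfl
  have hV' : gridTracked L N β u (-v) = S.V := rfl
  set X₀ : GridLeg (GridPoint L N) := (((((0 : Fin N), x) : GridPoint L N), σ), 0)
  set Y₀ : GridLeg (GridPoint L N) := (((((0 : Fin N), y) : GridPoint L N), σ'), 1)
  have hbound := hV.norm_twoPoint_div_le X₀ Y₀
  rw [(betaUSetup_E Cuv Csl d₀ Λ₀ κU β μ K u).2.2.2] at hbound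
  refine ⟨?_, ?_⟩
  · -- the denominator: `N_w · Z_grid`, both nonzero
    have hN0 := gaussExpect_shifted_grassmannExp_smul_momentumDensity_ne_zero (L := L) (M := M) hβ0 μ (θ := 0)
      (by rw [mul_zero, abs_zero]; positivity) (w := -(u / 2) - v) (by rw [zero_add]; exact hw)
    have hden : hubbardRatioDen L M β μ u =
        gaussExpect ℂ (hubbardCovariance L M β μ 0) (grassmannExp ((-(u / 2) - v) • momentumDensity L M β)) *
          effPartitionFn ℂ S.covFull S.V := by
      rw [hubbardRatioDen, show grassmannExp (-hubbardComplexAction L M β u) = 1 * grassmannExp (-hubbardComplexAction L M β u) by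
        rw [one_mul], gaussExpect_mul_grassmannExp_neg_hubbardComplexAction hβ0 μ u v hw, one_mul,
        show grassmannExp (-(u • hubbardInteraction L M β 1 + -v • momentumDensity L M β)) =
          ExteriorAlgebra.map (Matrix.toLin' (hubbardGridSub L M β N)) (grassmannExp (-gridTracked L N β u (-v))) by
          rw [map_grassmannExp_eq, map_neg, map_hubbardGridSub_gridTracked hβ0.ne' hMN hMN'],
        gaussExpect_map, LinearMap.toMatrix'_toLin', ← effPartitionFn_eq_gaussExpect, hcov, hV']
    rw [hden]
    rw [hubbardCovFullShifted_zero] at hN0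
    exact mul_ne_zero hN0 hV.effAction_full_eq.2.ne_zero
  · rw [hgrid, hcov, hV']
    exact hbound

end Main

end Literature.MathematicalPhysics.QuantumLattice

end
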